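import Literature.Geometry.Lorentzian.KerrSchildMultiplierCurrent
import HarnessLib

/-!
# Perturbation of multiplier currents in the coefficients: `J^X[G] − J^X[G'] = J^X[G − G']`,
# `K^X[G] − K^X[G'] = K^X[G − G']`, and the bound `|K^X[H]| ≤ (24 h₀ ξ₁ + 8 ξ₀ h₁) ∑ (∂w)²`

(family `gr`; infrastructure for the physical-space multiplier estimates behind statement
**gr.S24** — Dafermos–Rodnianski–Shlapentokh-Rothman, arXiv:1402.7034, §4.6 ("this inequality is
preserved when `X`, `w` are defined for `g_{M,a}` again as above", Dafermos–Rodnianski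
arXiv:1010.5132, §6) — in the coefficient-field framework of `KerrSchild.waveOperator`; namespace
`Literature.Geometry.Lorentzian.KerrSchild`)

The large-`r` multiplier estimates of Dafermos–Rodnianski and DRSR are proved by computing the
bulk `K^{X,w}` of a radial current exactly for a model metric (Minkowski or Schwarzschild;
`MinkowskiRadialMultiplier.lean`) and observing that the Kerr metric changes the coefficients of
the quadratic form by terms which are small for large `r` (`g⁻¹_{M,a} = η⁻¹ − 2H ℓ♯ ⊗ ℓ♯` with
`2H = O(M/r)`, `∂(2H ℓ♯ ⊗ ℓ♯) = O(M/r²)`). In the coefficient-field framework the current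
`(J^X)^μ` and the bulk `K^X` of `KerrSchildMultiplierCurrent.lean` are **linear in the coefficient
field** `G`, so the comparison is an identity plus a crude bound:

* `KerrSchild.multiplierCurrent_sub_coeff` — `J^X[G](x) − J^X[G'](x) = J^X[G − G'](x)`
  (pointwise, no hypotheses);
* `KerrSchild.multiplierBulk_sub_coeff` — `K^X[G](x) − K^X[G'](x) = K^X[G − G'](x)` for `G`, `G'`
  differentiable at `x`;
* `KerrSchild.abs_multiplierBulk_le` — for any coefficient field `H` (e.g. `H = G − G'`) with
  `|H^{αβ}(x)| ≤ h₀`, `|∂_μ H^{αβ}(x)| ≤ h₁`, and a multiplier with `|X^α(x)| ≤ ξ₀`,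
  `|∂_μ X^β(x)| ≤ ξ₁`: `|K^X[H](x)| ≤ (24 h₀ ξ₁ + 8 ξ₀ h₁) ∑_μ (∂_μ w)²(x)`;
* `KerrSchild.abs_sum_multiplierCurrent_mul_le_of_coeff` — `|∑_μ (J^X[H])^μ n_μ| ≤ 24 h₀ ξ₀ ν₀ ∑ (∂w)²`
  for `|n_μ| ≤ ν₀` (the flux through a hypersurface element changes little);
* `KerrSchild.multiplierBulk_ge_of_perturbation` — the form in which it is used: if
  `K^X[G'] ≥ Q₀` (model positivity) then `K^X[G] ≥ Q₀ − (24 h₀ ξ₁ + 8 ξ₀ h₁) ∑ (∂w)²`.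

## References

* M. Dafermos, I. Rodnianski, Y. Shlapentokh-Rothman, arXiv:1402.7034 = Ann. of Math. 183 (2016),
  §4.6, Prop. 4.6.1 (key `DafermosRodnianskiShlapentokhrothman2014`).
* M. Dafermos, I. Rodnianski, *Decay for solutions of the wave equation on Kerr exterior
  spacetimes I–II*, arXiv:1010.5132, §6 ("this inequality is preserved when `X`, `w` are defined
  for `g_{M,a}`") (key `DafermosRodnianski2010`).
-/

noncomputable section

open Set Filter
open scoped ContDiff Topology

namespace Literature.Geometry.Lorentzian

namespace KerrSchild

/-! ### Linearity in the coefficient field -/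

/-- **The current is linear in the coefficients**: `J^X[G] − J^X[G'] = J^X[G − G']`, pointwise.
[folklore] -/
theorem multiplierCurrent_sub_coeff (G G' : E4 → Fin 4 → Fin 4 → ℝ) (X : E4 → Fin 4 → ℝ)
    (w : E4 → ℝ) (x : E4) (μ : Fin 4) :
    multiplierCurrent G X w x μ - multiplierCurrent G' X w x μ =
      multiplierCurrent (G - G') X w x μ := by
  simp only [multiplierCurrent, Pi.sub_apply, sub_mul, Finset.sum_sub_distrib]
  ring

/-- **The bulk is linear in the coefficients**: `K^X[G] − K^X[G'] = K^X[G − G']` at every point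
where both coefficient fields are differentiable. [folklore] -/
theorem multiplierBulk_sub_coeff {G G' : E4 → Fin 4 → Fin 4 → ℝ} (X : E4 → Fin 4 → ℝ)
    (w : E4 → ℝ) {x : E4} (hG : ∀ α β, DifferentiableAt ℝ (fun y ↦ G y α β) x)
    (hG' : ∀ α β, DifferentiableAt ℝ (fun y ↦ G' y α β) x) :
    multiplierBulk G X w x - multiplierBulk G' X w x = multiplierBulk (G - G') X w x := by
  have hd : ∀ α β, fderiv ℝ (fun y ↦ G y α β - G' y α β) x =
      fderiv ℝ (fun y ↦ G y α β) x - fderiv ℝ (fun y ↦ G' y α β) x := fun α β ↦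
    ((hG α β).hasFDerivAt.sub (hG' α β).hasFDerivAt).fderiv
  simp only [multiplierBulk, Pi.sub_apply, hd, sub_apply]
  -- both sides are the same combination of finitely many sums (linearity in `G`, `∂G`)
  simp only [sub_mul, mul_sub, Finset.sum_sub_distrib]
  ring

/-! ### Crude bounds -/

/-- `|∑_{μ<4} a_μ b_μ| ≤ (∑ |a_μ|) (∑ |b_μ|)`-type bound: `|∑_μ a_μ| ≤ ∑_μ |a_μ|` and
`(∑_μ |p_μ|)² ≤ 4 ∑ p_μ²` combine to control the bilinear expressions below. This lemma:
`|∑_μ u_μ v_μ| ≤ U (∑ |v_μ|)` when `|u_μ| ≤ U`. [folklore] -/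
theorem abs_sum_mul_le_of_abs_le {U : ℝ} (u v : Fin 4 → ℝ) (hu : ∀ μ, |u μ| ≤ U) :
    |∑ μ, u μ * v μ| ≤ U * ∑ μ, |v μ| := by
  calc |∑ μ, u μ * v μ| ≤ ∑ μ, |u μ * v μ| := Finset.abs_sum_le_sum_abs _ _
    _ ≤ ∑ μ, U * |v μ| := Finset.sum_le_sum fun μ _ ↦ by
        rw [abs_mul]; exact mul_le_mul_of_nonneg_right (hu μ) (abs_nonneg _)
    _ = U * ∑ μ, |v μ| := by rw [Finset.mul_sum]

/-- `|∑_ν H^{μν} p_ν| ≤ h₀ ∑ |p_ν|` when `|H^{μν}| ≤ h₀`. [folklore] -/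
theorem abs_contract_le {h₀ : ℝ} (H : Fin 4 → Fin 4 → ℝ) (p : Fin 4 → ℝ)
    (hH : ∀ μ ν, |H μ ν| ≤ h₀) (μ : Fin 4) : |∑ ν, H μ ν * p ν| ≤ h₀ * ∑ ν, |p ν| :=
  abs_sum_mul_le_of_abs_le (H μ) p (hH μ)

/-- **Crude bound for the bulk of a multiplier in terms of sup bounds on the coefficients.** For a
coefficient field `H` with `|H^{αβ}(x)| ≤ h₀`, `|∂_μ H^{αβ}(x)| ≤ h₁` and a multiplier with
`|X^α(x)| ≤ ξ₀`, `|∂_μ X^β(x)| ≤ ξ₁`: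
`|K^X[H](x)| ≤ (24 h₀ ξ₁ + 8 ξ₀ h₁) ∑_μ (∂_μw)²(x)`
(the three terms of `K^X` are bounded by `16 h₀ξ₁`, `8 ξ₁h₀` and `8 ξ₀h₁` times `∑ (∂w)²`, using
`(∑|p_μ|)² ≤ 4 ∑ p_μ²`). Applied to `H = g⁻¹_{M,a} − η⁻¹ = −2H ℓ♯ ⊗ ℓ♯` this is the statement that
the Kerr bulk differs from the Minkowski bulk by `O((M/r)|∂X| + (M/r²)|X|) |∂w|²`
(Dafermos–Rodnianski arXiv:1010.5132, §6). [cite: DafermosRodnianski2010, §6] -/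
theorem abs_multiplierBulk_le (H : E4 → Fin 4 → Fin 4 → ℝ) (X : E4 → Fin 4 → ℝ) (w : E4 → ℝ)
    (x : E4) {h₀ h₁ ξ₀ ξ₁ : ℝ} (hh₀ : 0 ≤ h₀) (hh₁ : 0 ≤ h₁) (hξ₀ : 0 ≤ ξ₀) (hξ₁ : 0 ≤ ξ₁)
    (hH : ∀ α β, |H x α β| ≤ h₀)
    (hdH : ∀ μ α β, |fderiv ℝ (fun y ↦ H y α β) x (E4.basisVector μ)| ≤ h₁)
    (hX : ∀ α, |X x α| ≤ ξ₀)
    (hdX : ∀ μ β, |fderiv ℝ (fun y ↦ X y β) x (E4.basisVector μ)| ≤ ξ₁) :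
    |multiplierBulk H X w x| ≤ (24 * h₀ * ξ₁ + 8 * ξ₀ * h₁) * ∑ μ, fderiv ℝ w x (E4.basisVector μ) ^ 2 := by
  -- name the atoms
  obtain ⟨p, hp⟩ : ∃ p : Fin 4 → ℝ, ∀ β, fderiv ℝ w x (E4.basisVector β) = p β := ⟨_, fun _ ↦ rfl⟩
  obtain ⟨dX, hdX'⟩ : ∃ dX : Fin 4 → Fin 4 → ℝ, ∀ μ β,
      fderiv ℝ (fun y ↦ X y β) x (E4.basisVector μ) = dX μ β := ⟨_, fun _ _ ↦ rfl⟩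
  obtain ⟨dH, hdH'⟩ : ∃ dH : Fin 4 → Fin 4 → Fin 4 → ℝ, ∀ μ α β,
      fderiv ℝ (fun y ↦ H y α β) x (E4.basisVector μ) = dH μ α β := ⟨_, fun _ _ _ ↦ rfl⟩
  have hdXb : ∀ μ β, |dX μ β| ≤ ξ₁ := fun μ β ↦ by rw [← hdX']; exact hdX μ β
  have hdHb : ∀ μ α β, |dH μ α β| ≤ h₁ := fun μ α β ↦ by rw [← hdH']; exact hdH μ α β
  simp only [multiplierBulk, hp, hdX', hdH']
  -- the basic quantities
  set S : ℝ := ∑ μ, p μ ^ 2 with hS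
  set P : ℝ := ∑ μ, |p μ| with hP
  have hS0 : 0 ≤ S := Finset.sum_nonneg fun μ _ ↦ sq_nonneg _
  have hP0 : 0 ≤ P := Finset.sum_nonneg fun μ _ ↦ abs_nonneg _
  have hP2 : P ^ 2 ≤ 4 * S := Kerr.sq_sum_abs_le_four_mul p
  -- term 1: `|∑_μ (∑_ν H^{μν} p_ν)(∑_β dX_μ^β p_β)| ≤ 4 (h₀ P)(ξ₁ P)`
  have hA : ∀ μ, |∑ ν, H x μ ν * p ν| ≤ h₀ * P := fun μ ↦ abs_contract_le (H x) p hH μ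
  have hB : ∀ μ, |∑ β, dX μ β * p β| ≤ ξ₁ * P := fun μ ↦ abs_sum_mul_le_of_abs_le _ p (hdXb μ)
  have h1 : |∑ μ, (∑ ν, H x μ ν * p ν) * ∑ β, dX μ β * p β| ≤ 4 * (h₀ * P) * (ξ₁ * P) := by
    calc |∑ μ, (∑ ν, H x μ ν * p ν) * ∑ β, dX μ β * p β|
        ≤ ∑ μ, |(∑ ν, H x μ ν * p ν) * ∑ β, dX μ β * p β| := Finset.abs_sum_le_sum_abs _ _
      _ ≤ ∑ _μ : Fin 4, (h₀ * P) * (ξ₁ * P) := Finset.sum_le_sum fun μ _ ↦ by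
          rw [abs_mul]
          exact mul_le_mul (hA μ) (hB μ) (abs_nonneg _) (mul_nonneg hh₀ hP0)
      _ = 4 * (h₀ * P) * (ξ₁ * P) := by
          rw [Finset.sum_const, Finset.card_univ, Fintype.card_fin, nsmul_eq_mul]; ring
  -- term 2: `|(∑_μ dX_μ^μ)(∑ H p p)| ≤ (4 ξ₁)(h₀ P²)`
  have hdiv : |∑ μ, dX μ μ| ≤ 4 * ξ₁ := by
    calc |∑ μ, dX μ μ| ≤ ∑ μ, |dX μ μ| := Finset.abs_sum_le_sum_abs _ _
      _ ≤ ∑ _μ : Fin 4, ξ₁ := Finset.sum_le_sum fun μ _ ↦ hdXb μ μ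
      _ = 4 * ξ₁ := by rw [Finset.sum_const, Finset.card_univ, Fintype.card_fin, nsmul_eq_mul]; ring
  have hQ : |∑ α, ∑ β, H x α β * p α * p β| ≤ h₀ * P * P := Kerr.abs_sum_sum_mul_mul_le (H x) p p hH
  have h2 : |2⁻¹ * (∑ μ, dX μ μ) * ∑ α, ∑ β, H x α β * p α * p β| ≤
      2⁻¹ * (4 * ξ₁) * (h₀ * P * P) := by
    rw [abs_mul, abs_mul, abs_of_pos (by norm_num : (0 : ℝ) < 2⁻¹)]
    exact mul_le_mul (mul_le_mul_of_nonneg_left hdiv (by norm_num)) hQ (abs_nonneg _)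
      (by positivity)
  -- term 3: `|∑_μ X^μ ∑ dH_μ p p| ≤ 4 ξ₀ (h₁ P²)`
  have hR : ∀ μ, |∑ α, ∑ β, dH μ α β * p α * p β| ≤ h₁ * P * P := fun μ ↦
    Kerr.abs_sum_sum_mul_mul_le (dH μ) p p (hdHb μ)
  have h3 : |2⁻¹ * ∑ μ, X x μ * ∑ α, ∑ β, dH μ α β * p α * p β| ≤
      2⁻¹ * (4 * (ξ₀ * (h₁ * P * P))) := by
    rw [abs_mul, abs_of_pos (by norm_num : (0 : ℝ) < 2⁻¹)]
    refine mul_le_mul_of_nonneg_left ?_ (by norm_num)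
    calc |∑ μ, X x μ * ∑ α, ∑ β, dH μ α β * p α * p β|
        ≤ ∑ μ, |X x μ * ∑ α, ∑ β, dH μ α β * p α * p β| := Finset.abs_sum_le_sum_abs _ _
      _ ≤ ∑ _μ : Fin 4, ξ₀ * (h₁ * P * P) := Finset.sum_le_sum fun μ _ ↦ by
          rw [abs_mul]
          exact mul_le_mul (hX μ) (hR μ) (abs_nonneg _) hξ₀
      _ = 4 * (ξ₀ * (h₁ * P * P)) := by
          rw [Finset.sum_const, Finset.card_univ, Fintype.card_fin, nsmul_eq_mul]; ring
  -- assemble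
  calc |(∑ μ, (∑ ν, H x μ ν * p ν) * ∑ β, dX μ β * p β) -
        2⁻¹ * (∑ μ, dX μ μ) * (∑ α, ∑ β, H x α β * p α * p β) -
        2⁻¹ * ∑ μ, X x μ * ∑ α, ∑ β, dH μ α β * p α * p β|
      ≤ |(∑ μ, (∑ ν, H x μ ν * p ν) * ∑ β, dX μ β * p β) -
          2⁻¹ * (∑ μ, dX μ μ) * (∑ α, ∑ β, H x α β * p α * p β)| +
        |2⁻¹ * ∑ μ, X x μ * ∑ α, ∑ β, dH μ α β * p α * p β| := abs_sub _ _
    _ ≤ (|∑ μ, (∑ ν, H x μ ν * p ν) * ∑ β, dX μ β * p β| +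
          |2⁻¹ * (∑ μ, dX μ μ) * (∑ α, ∑ β, H x α β * p α * p β)|) +
        |2⁻¹ * ∑ μ, X x μ * ∑ α, ∑ β, dH μ α β * p α * p β| :=
        add_le_add (abs_sub _ _) le_rfl
    _ ≤ (4 * (h₀ * P) * (ξ₁ * P) + 2⁻¹ * (4 * ξ₁) * (h₀ * P * P)) +
        2⁻¹ * (4 * (ξ₀ * (h₁ * P * P))) := add_le_add (add_le_add h1 h2) h3
    _ = (6 * h₀ * ξ₁ + 2 * ξ₀ * h₁) * P ^ 2 := by ring
    _ ≤ (6 * h₀ * ξ₁ + 2 * ξ₀ * h₁) * (4 * S) :=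
        mul_le_mul_of_nonneg_left hP2 (by positivity)
    _ = (24 * h₀ * ξ₁ + 8 * ξ₀ * h₁) * S := by ring

/-- **Crude bound for the flux of `J^X[H]` through a conormal**: with `|H^{αβ}(x)| ≤ h₀`,
`|X^α(x)| ≤ ξ₀`, `|n_μ| ≤ ν₀`: `|∑_μ (J^X[H])^μ n_μ| ≤ 24 h₀ ξ₀ ν₀ ∑_μ (∂_μw)²(x)`.
[cite: DafermosRodnianski2010, §6] -/
theorem abs_sum_multiplierCurrent_mul_le_of_coeff (H : E4 → Fin 4 → Fin 4 → ℝ)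
    (X : E4 → Fin 4 → ℝ) (w : E4 → ℝ) (x : E4) (n : Fin 4 → ℝ) {h₀ ξ₀ ν₀ : ℝ} (hh₀ : 0 ≤ h₀)
    (hξ₀ : 0 ≤ ξ₀) (hν₀ : 0 ≤ ν₀) (hH : ∀ α β, |H x α β| ≤ h₀) (hX : ∀ α, |X x α| ≤ ξ₀)
    (hn : ∀ μ, |n μ| ≤ ν₀) :
    |∑ μ, multiplierCurrent H X w x μ * n μ| ≤
      24 * h₀ * ξ₀ * ν₀ * ∑ μ, fderiv ℝ w x (E4.basisVector μ) ^ 2 := by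
  obtain ⟨p, hp⟩ : ∃ p : Fin 4 → ℝ, ∀ β, fderiv ℝ w x (E4.basisVector β) = p β := ⟨_, fun _ ↦ rfl⟩
  simp only [multiplierCurrent, hp]
  set S : ℝ := ∑ μ, p μ ^ 2 with hS
  set P : ℝ := ∑ μ, |p μ| with hP
  have hS0 : 0 ≤ S := Finset.sum_nonneg fun μ _ ↦ sq_nonneg _
  have hP0 : 0 ≤ P := Finset.sum_nonneg fun μ _ ↦ abs_nonneg _
  have hP2 : P ^ 2 ≤ 4 * S := Kerr.sq_sum_abs_le_four_mul p
  have hA : ∀ μ, |∑ ν, H x μ ν * p ν| ≤ h₀ * P := fun μ ↦ abs_contract_le (H x) p hH μ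
  have hXp : |∑ α, X x α * p α| ≤ ξ₀ * P := abs_sum_mul_le_of_abs_le _ p hX
  have hQ : |∑ α, ∑ β, H x α β * p α * p β| ≤ h₀ * P * P := Kerr.abs_sum_sum_mul_mul_le (H x) p p hH
  have hterm : ∀ μ, |((∑ ν, H x μ ν * p ν) * ∑ α, X x α * p α -
      2⁻¹ * X x μ * ∑ α, ∑ β, H x α β * p α * p β) * n μ| ≤
      ((h₀ * P) * (ξ₀ * P) + 2⁻¹ * ξ₀ * (h₀ * P * P)) * ν₀ := by
    intro μ
    rw [abs_mul]
    refine mul_le_mul ?_ (hn μ) (abs_nonneg _) (by positivity)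
    calc |(∑ ν, H x μ ν * p ν) * ∑ α, X x α * p α -
          2⁻¹ * X x μ * ∑ α, ∑ β, H x α β * p α * p β|
        ≤ |(∑ ν, H x μ ν * p ν) * ∑ α, X x α * p α| +
            |2⁻¹ * X x μ * ∑ α, ∑ β, H x α β * p α * p β| := abs_sub _ _
      _ ≤ (h₀ * P) * (ξ₀ * P) + 2⁻¹ * ξ₀ * (h₀ * P * P) := by
          refine add_le_add ?_ ?_
          · rw [abs_mul]
            exact mul_le_mul (hA μ) hXp (abs_nonneg _) (mul_nonneg hh₀ hP0)
          · rw [abs_mul, abs_mul, abs_of_pos (by norm_num : (0 : ℝ) < 2⁻¹)]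
            exact mul_le_mul (mul_le_mul_of_nonneg_left (hX μ) (by norm_num)) hQ
              (abs_nonneg _) (by positivity)
  calc |∑ μ, ((∑ ν, H x μ ν * p ν) * ∑ α, X x α * p α -
        2⁻¹ * X x μ * ∑ α, ∑ β, H x α β * p α * p β) * n μ|
      ≤ ∑ μ, |((∑ ν, H x μ ν * p ν) * ∑ α, X x α * p α -
          2⁻¹ * X x μ * ∑ α, ∑ β, H x α β * p α * p β) * n μ| := Finset.abs_sum_le_sum_abs _ _
    _ ≤ ∑ _μ : Fin 4, ((h₀ * P) * (ξ₀ * P) + 2⁻¹ * ξ₀ * (h₀ * P * P)) * ν₀ :=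
        Finset.sum_le_sum fun μ _ ↦ hterm μ
    _ = 6 * h₀ * ξ₀ * ν₀ * P ^ 2 := by
        rw [Finset.sum_const, Finset.card_univ, Fintype.card_fin, nsmul_eq_mul]; ring
    _ ≤ 6 * h₀ * ξ₀ * ν₀ * (4 * S) := mul_le_mul_of_nonneg_left hP2 (by positivity)
    _ = 24 * h₀ * ξ₀ * ν₀ * S := by ring

/-- **Positivity survives small perturbations of the coefficients** (DRSR arXiv:1402.7034, §4.6;
Dafermos–Rodnianski arXiv:1010.5132, §6: "this inequality is preserved when `X`, `w` are defined for
`g_{M,a}`"): if the model bulk satisfies `K^X[G'](x) ≥ Q₀` and `H = G − G'` obeys the sup bounds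
of `abs_multiplierBulk_le`, then `K^X[G](x) ≥ Q₀ − (24 h₀ ξ₁ + 8 ξ₀ h₁) ∑ (∂w)²(x)`.
[cite: DafermosRodnianskiShlapentokhrothman2014, §4.6] -/
theorem multiplierBulk_ge_of_perturbation {G G' : E4 → Fin 4 → Fin 4 → ℝ} (X : E4 → Fin 4 → ℝ)
    (w : E4 → ℝ) {x : E4} (hG : ∀ α β, DifferentiableAt ℝ (fun y ↦ G y α β) x)
    (hG' : ∀ α β, DifferentiableAt ℝ (fun y ↦ G' y α β) x) {h₀ h₁ ξ₀ ξ₁ Q₀ : ℝ}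
    (hh₀ : 0 ≤ h₀) (hh₁ : 0 ≤ h₁) (hξ₀ : 0 ≤ ξ₀) (hξ₁ : 0 ≤ ξ₁)
    (hH : ∀ α β, |(G - G') x α β| ≤ h₀)
    (hdH : ∀ μ α β, |fderiv ℝ (fun y ↦ (G - G') y α β) x (E4.basisVector μ)| ≤ h₁)
    (hX : ∀ α, |X x α| ≤ ξ₀)
    (hdX : ∀ μ β, |fderiv ℝ (fun y ↦ X y β) x (E4.basisVector μ)| ≤ ξ₁)
    (hmodel : Q₀ ≤ multiplierBulk G' X w x) :
    Q₀ - (24 * h₀ * ξ₁ + 8 * ξ₀ * h₁) * ∑ μ, fderiv ℝ w x (E4.basisVector μ) ^ 2 ≤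
      multiplierBulk G X w x := by
  have hdiff := multiplierBulk_sub_coeff X w hG hG' (x := x)
  have hbound := abs_multiplierBulk_le (G - G') X w x hh₀ hh₁ hξ₀ hξ₁ hH hdH hX hdX
  have h := neg_abs_le (multiplierBulk (G - G') X w x)
  linarith

end KerrSchild

end Literature.Geometry.Lorentzian
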